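import Summits.CriticalPhenomena.CardyFormulaZ2.Theorems.CardyMagicRigidityNestingRigidityFirstGenT
import Summits.CriticalPhenomena.CardyFormulaZ2.Theorems.CardyMagicRigidityNestingRigidityOneGenerationTLocality
import Literature.Probability.Percolation.SiteNestingWeightBound
import HarnessLib

/-!
# The first generation of the closed-b.c. site-`𝕋` domain ensemble is a stopping set

Crux `Summit.CriticalPhenomena.CardyFormulaZ2.Theses.CardyMagicRigidity.NestingRigidity`
(stmt-CriticalPhenomena-4835), line `markov-cascade-one-generation`, registered helper (wave 3)
`firstGen_domLoopsT_eq_of_agree_outside` toward `stub_cascadeReconstruction` (vocabulary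
`Theorems/CardyMagicRigidityMarkovCascadeDefs.lean`: `firstGen`, `domLoopsT`): the combinatorial half
of the domain Markov property of the honeycomb-loop ensemble with closed boundary condition.

**Statement.** Let `δ > 0`, `U` bounded, and let two site configurations `ω`, `ω'` agree on every
site `x` such that, for every first-generation (outermost) loop `u` of
`domLoopsT U δ ω = siteLoopConfig δ (ω ∩ triMeshVertices U δ)`, either `u` does not wind about the
site (`W_u(δx) = 0`) or the site is within `δ/2` of the trace of `u` (the sites READ by `u`: the two
sites of the `𝕋`-edge crossed by a dart of `u` are at distance exactly `δ/2` from the crossing point,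
the common midpoint of the edge and of the dart piece, `IsSiteInterfaceLoop.midpoint_polyPt_eq`,
`dist_leftPt_rightPt`).  Then `firstGen (domLoopsT U δ ω') = firstGen (domLoopsT U δ ω)`.

**Proof** (Camia–Newman CMP 268 §2, locality of cluster interfaces; all at mesh `δ`, for the finite
configurations `β = ω ∩ U_δ`, `β' = ω' ∩ U_δ`, which agree on the sites `x` above).
The key lattice lemma `infDist_polyTrace_le_of_wind_ne_zero` (§1): if `γ'`, `γ₂` are interface loops
of ONE configuration, the winding interior of `γ'` is not strictly inside that of `γ₂`, and a site `x`
read by `γ'` is enclosed by `γ₂`, then `x` is within `δ/2` of the trace of `γ₂`.  Indeed the interiors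
are nested or disjoint (`interior_trichotomy`, Jordan); `int γ' ⊆ int γ₂` forces equality, hence equal
traces (the trace is the frontier of the interior, `IsJordanLoop.frontier_inside`) and `x` is within
`δ/2` of its own loop's trace; in the two other cases exactly one of the two sites `x`, `y` of the edge
crossed by `γ'` at `x` is enclosed by `γ'` (jump of the winding number, values in `{0, ±1}`), which
places `x` inside and `y` outside `γ₂`, so `γ₂` crosses the edge `xy` (transport of the winding number
across an uncrossed edge, `loopWind_triMeshPoint_eq_of_adj`) and reads `x`.
Consequences (§2): (1) every first-generation loop `γ` of `β` reads only sites on which `β`, `β'`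
agree, so it is an interface loop of `β'` (cylinder property `isSiteInterfaceLoop_congr`);
(2) OUTSIDE LOCALITY: an interface loop of `β'` whose interior is not strictly inside that of any
first-generation loop of `β` reads only such sites too (apply the lemma in `β'`, the first-generation
loops of `β` being loops of `β'` by (1)), so it is an interface loop of `β`.  (3) Hence a
first-generation loop of `β'` is a loop of `β`, and it is outermost in `β`: an enclosing loop of `β`
would have an outermost enclosing one (finitely many loops, `ncard_loops_siteLoopConfig_meeting_le`),
of the first generation of `β` — excluded; conversely a first-generation loop `γ` of `β` is a loop of
`β'` by (1), and a loop of `β'` strictly enclosing it is not strictly inside the first generation of `β`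
(that would put `γ` strictly inside another loop of `β`), hence is a loop of `β` by (2) — excluded.
-/

noncomputable section

open Set Metric

namespace Summit.CriticalPhenomena.CardyFormulaZ2.Cruxes.NestingRigidity.MarkovCascadeOneGeneration

open Literature.Probability.RandomPlanarGeometry Literature.Probability.Percolation
  Literature.Probability.LatticeModels Literature.Topology.PlaneTopology

/-! ## §1 Lattice geometry of interface loops of one configuration -/

section Geometry

variable {ω : SiteConfig (Site 2)} {f₀ f₁ : HexVertex} {w : hexGraph.Walk f₀ f₀} {w' : hexGraph.Walk f₁ f₁}

/-- The Jordan parametrisation of the polygon of a closed walk of `H` (the local notation of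
`…OneGenerationTInterior`, unfolded identically). -/
local notation3 "JL⟦" δ ", " w "⟧" =>
  (fun t : ℝ ↦ IccExtend zero_le_one (⇑(hexLoopCurve δ w)) (tailStart (SimpleGraph.Walk.length w) * Int.fract t))

/-- **Two cycles of `H` with the same winding interior at mesh `δ ≠ 0` have the same trace**: the
trace is the frontier of the inside of the Jordan curve (`IsJordanLoop.frontier_inside`), which is
the winding interior (`inside_hexJordanLoop_eq`). -/
theorem polyTrace_eq_of_interior_eq {δ : ℝ} (hδ : δ ≠ 0) (hw : w.IsCycle) (hw' : w'.IsCycle)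
    (h : {z | (siteLoopCurve δ w).wind z ≠ 0} = {z | (siteLoopCurve δ w').wind z ≠ 0}) :
    polyTrace δ w = polyTrace δ w' := by
  have hlen : 0 < w.length := by have := hw.three_le_length; omega
  have hlen' : 0 < w'.length := by have := hw'.three_le_length; omega
  rw [← range_hexJordanLoop_eq_polyTrace δ hlen, ← range_hexJordanLoop_eq_polyTrace δ hlen',
    ← (isJordanLoop_hexJordanLoop hδ hw).frontier_inside,
    ← (isJordanLoop_hexJordanLoop hδ hw').frontier_inside, inside_hexJordanLoop_eq hδ hw,
    inside_hexJordanLoop_eq hδ hw', h]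

/-- **The sites read by a dart are within `δ/2` of the trace**: the midpoint of the crossed edge
`[leftPt i, rightPt i]` (length `δ`) is the midpoint of the `i`-th dart piece, a point of the trace. -/
theorem infDist_polyTrace_le_of_lv_or_rv (hw : IsSiteInterfaceLoop ω w) {δ : ℝ} (hδ : 0 < δ) {i : ℕ}
    (hi : i < w.length) {x : Site 2} (hx : x = hw.lv i ∨ x = hw.rv i) :
    infDist (triMeshPoint δ x) (polyTrace δ w) ≤ δ / 2 := by
  have hM : midpoint ℝ (hw.leftPt δ i) (hw.rightPt δ i) ∈ polyTrace δ w := by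
    rw [← hw.midpoint_polyPt_eq hi]
    exact polyPiece_subset_polyTrace hi (midpoint_mem_segment _ _)
  have hd := hw.dist_leftPt_rightPt hδ.le hi
  refine (infDist_le_dist_of_mem hM).trans (le_of_eq ?_)
  rcases hx with rfl | rfl
  · change dist (hw.leftPt δ i) _ = _
    rw [dist_left_midpoint, hd, Real.norm_two]
    ring
  · change dist (hw.rightPt δ i) _ = _
    rw [dist_right_midpoint, hd, Real.norm_two]
    ring

/-- **Exactly one of the two sites of a crossed edge is enclosed**: the winding numbers at the left
and right sites of the `i`-th step are `(1, 0)` (anticlockwise loop) or `(0, -1)` (clockwise loop). -/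
theorem loopWind_lv_ne_zero_iff (hw : IsSiteInterfaceLoop ω w) {δ : ℝ} (hδ : 0 < δ) {i : ℕ}
    (hi : i < w.length) :
    loopWind δ w (triMeshPoint δ (hw.lv i)) ≠ 0 ↔ loopWind δ w (triMeshPoint δ (hw.rv i)) = 0 := by
  have h1 : loopWind δ w (triMeshPoint δ (hw.lv i)) = loopWind δ w (hw.leftPt δ 0) :=
    hw.loopWind_leftPt_eq_loopWind_leftPt_zero hδ hi
  have h2 : loopWind δ w (triMeshPoint δ (hw.rv i)) = loopWind δ w (hw.leftPt δ 0) - 1 :=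
    hw.loopWind_rightPt_eq hδ hi
  rw [h1, h2]
  rcases hw.loopWind_leftPt_zero_eq_zero_or_one hδ with h3 | h3 <;> rw [h3] <;> decide

/-- **Key lattice lemma.**  Let `γ'`, `γ₂` be interface loops of ONE configuration at mesh `δ > 0`,
the winding interior of `γ'` not strictly inside that of `γ₂`, and let `x` be a site read by `γ'`
(a left or right site of one of its steps) enclosed by `γ₂`.  Then `x` is within `δ/2` of the trace
of `γ₂` (in fact `x` is read by `γ₂`, or `γ₂` and `γ'` have the same trace).  See the module
docstring. -/
theorem infDist_polyTrace_le_of_wind_ne_zero (h' : IsSiteInterfaceLoop ω w') (h₂ : IsSiteInterfaceLoop ω w)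
    {δ : ℝ} (hδ : 0 < δ)
    (hns : ¬ ({z | (siteLoopCurve δ w').wind z ≠ 0} ⊂ {z | (siteLoopCurve δ w).wind z ≠ 0}))
    {i : ℕ} (hi : i < w'.length) {x : Site 2} (hx : x = h'.lv i ∨ x = h'.rv i)
    (hwx : (siteLoopCurve δ w).wind (triMeshPoint δ x) ≠ 0) :
    infDist (triMeshPoint δ x) (polyTrace δ w) ≤ δ / 2 := by
  have hlen' : 0 < w'.length := by omega
  have hlen₂ : 0 < w.length := by have := h₂.isCycle.three_le_length; omega
  have hW' : ∀ a : Site 2, (siteLoopCurve δ w').wind (triMeshPoint δ a) = loopWind δ w' (triMeshPoint δ a) :=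
    fun a ↦ wind_siteLoopCurve_eq_loopWind hlen' (h'.triMeshPoint_not_mem_polyTrace hδ a)
  have hW₂ : ∀ a : Site 2, (siteLoopCurve δ w).wind (triMeshPoint δ a) = loopWind δ w (triMeshPoint δ a) :=
    fun a ↦ wind_siteLoopCurve_eq_loopWind hlen₂ (h₂.triMeshPoint_not_mem_polyTrace hδ a)
  rcases interior_trichotomy h₂ h' hδ with hsub | h23
  · -- `int γ' ⊆ int γ₂`, not strictly: same interior, same trace, and `x` is read by `γ'`
    have heq := (hsub.eq_or_lt.resolve_right hns)
    rw [← polyTrace_eq_of_interior_eq hδ.ne' h'.isCycle h₂.isCycle heq]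
    exact infDist_polyTrace_le_of_lv_or_rv h' hδ hi hx
  -- otherwise let `y` be the other site of the edge crossed by `γ'` at `x`
  obtain ⟨y, hadj, hiff⟩ : ∃ y : Site 2, triGraph.Adj x y ∧
      (loopWind δ w' (triMeshPoint δ x) ≠ 0 ↔ loopWind δ w' (triMeshPoint δ y) = 0) := by
    have hE := loopWind_lv_ne_zero_iff h' hδ hi
    rcases hx with rfl | rfl
    · exact ⟨h'.rv i, h'.adj_lv_rv hi, hE⟩
    · exact ⟨h'.lv i, (h'.adj_lv_rv hi).symm, by tauto⟩
  have hxin : triMeshPoint δ x ∈ {z | (siteLoopCurve δ w).wind z ≠ 0} := hwx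
  -- `y` is not enclosed by `γ₂`
  have hy₂ : loopWind δ w (triMeshPoint δ y) = 0 := by
    by_contra hy
    have hyin : triMeshPoint δ y ∈ {z | (siteLoopCurve δ w).wind z ≠ 0} := by
      rw [mem_setOf_eq, hW₂]; exact hy
    rcases h23 with hsub | hdis
    · -- `int γ₂ ⊆ int γ'`: `x` is enclosed by `γ'`, so `y` is not — but it is enclosed by `γ₂`
      have hx' : loopWind δ w' (triMeshPoint δ x) ≠ 0 := by rw [← hW']; exact hsub hxin
      have hy' : loopWind δ w' (triMeshPoint δ y) ≠ 0 := by rw [← hW']; exact hsub hyin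
      exact hy' (hiff.1 hx')
    · -- disjoint interiors: `x` is not enclosed by `γ'`, so `y` is — but it is enclosed by `γ₂`
      have hx' : loopWind δ w' (triMeshPoint δ x) = 0 := by
        by_contra hx'
        exact disjoint_left.1 hdis hxin (by rw [mem_setOf_eq, hW']; exact hx')
      have hy' : loopWind δ w' (triMeshPoint δ y) = 0 := by
        by_contra hy'
        exact disjoint_left.1 hdis hyin (by rw [mem_setOf_eq, hW']; exact hy')
      exact (hiff.2 hy') hx'
  -- so `γ₂` crosses the edge `x y`: `x` is read by `γ₂`
  by_cases hex : ∃ j, j < w.length ∧ ((x = h₂.lv j ∧ y = h₂.rv j) ∨ (x = h₂.rv j ∧ y = h₂.lv j))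
  · obtain ⟨j, hj, hj'⟩ := hex
    refine infDist_polyTrace_le_of_lv_or_rv h₂ hδ hj ?_
    rcases hj' with ⟨h1, -⟩ | ⟨h1, -⟩
    exacts [Or.inl h1, Or.inr h1]
  · have htrans := h₂.loopWind_triMeshPoint_eq_of_adj hδ (Or.inr hadj) fun j hj ↦
      ⟨fun hh ↦ hex ⟨j, hj, Or.inl hh⟩, fun hh ↦ hex ⟨j, hj, Or.inr hh⟩⟩
    rw [hW₂] at hwx
    exact absurd (htrans.trans hy₂) hwx

end Geometry

/-! ## §2 The loops of `siteLoopConfig`; the registered helper -/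

section Config

/-- The unbased loop of a closed honeycomb walk drawn at mesh `δ` (local notation). -/
local notation3 "UL⟦" δ ", " γ "⟧" =>
  UnbasedLoop.mk (BasedLoop.mk (siteLoopCurve δ γ) (isLoop_siteLoopCurve δ γ))

/-- The loops of `siteLoopConfig δ ω` (both types together) are the unbased loops of the interface
loops of `ω`. -/
theorem mem_loops_siteLoopConfig_iff {δ : ℝ} {ω : SiteConfig (Site 2)} {u : UnbasedLoop ℂ} :
    u ∈ (siteLoopConfig δ ω).loops ↔
      ∃ (v : HexVertex) (γ : hexGraph.Walk v v), IsSiteInterfaceLoop ω γ ∧ u = UL⟦δ, γ⟧ := by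
  constructor
  · rintro (⟨v, γ, hγ, -, rfl⟩ | ⟨v, γ, hγ, -, rfl⟩) <;> exact ⟨v, γ, hγ, rfl⟩
  · rintro ⟨v, γ, hγ, rfl⟩
    rcases lt_or_ge 0 (shoelace (γ.support.map hexCenter)) with hpos | hnp
    · exact Or.inr ⟨v, γ, hγ, ⟨fun _ ↦ hpos, fun _ ↦ rfl⟩, rfl⟩
    · exact Or.inl ⟨v, γ, hγ, ⟨fun h ↦ absurd h (by decide), fun h ↦ absurd h (not_lt.2 hnp)⟩, rfl⟩

/-- Membership in the loops of the first generation: a loop of `c` whose winding interior is not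
strictly inside that of another loop of `c`. -/
theorem mem_firstGen_loops_iff {c : LoopConfig ℂ} {u : UnbasedLoop ℂ} :
    u ∈ (firstGen c).loops ↔
      u ∈ c.loops ∧ ∀ v ∈ c.loops, ¬ ({z | u.wind z ≠ 0} ⊂ {z | v.wind z ≠ 0}) := by
  change (u ∈ c.F 0 ∧ _) ∨ (u ∈ c.F 1 ∧ _) ↔ (u ∈ c.F 0 ∨ u ∈ c.F 1) ∧ _
  exact or_and_right.symm

/-- **A configuration with finitely many open sites has finitely many interface loops** at mesh
`δ > 0`: all traces lie within `δ` of the open sites (`polyTrace_subset_cthickening_image`), so every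
loop meets one fixed ball (`ncard_loops_siteLoopConfig_meeting_le`). -/
theorem loops_siteLoopConfig_finite {δ : ℝ} (hδ : 0 < δ) {ω : SiteConfig (Site 2)} (hfin : ω.Finite) :
    (siteLoopConfig δ ω).loops.Finite := by
  obtain ⟨ρ, hρ⟩ :=
    ((hfin.image (triMeshPoint δ)).isBounded.cthickening (δ := δ)).subset_closedBall (0 : ℂ)
  refine (ncard_loops_siteLoopConfig_meeting_le hδ ρ ω).1.subset fun u hu ↦ ⟨hu, ?_⟩
  obtain ⟨v, γ, hγ, rfl⟩ := mem_loops_siteLoopConfig_iff.1 hu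
  have hlen : 0 < γ.length := by have := hγ.isCycle.three_le_length; omega
  have h0 : polyPt δ γ 0 ∈ polyTrace δ γ := polyPiece_subset_polyTrace hlen (left_mem_segment ℝ _ _)
  refine ⟨polyPt δ γ 0, ?_, hρ (polyTrace_subset_cthickening_image hγ hδ.le h0)⟩
  rw [range_mk_siteLoopCurve, range_toCurve_eq_polyTrace hlen]
  exact h0

variable {ω : SiteConfig (Site 2)} {f₁ : HexVertex} {w' : hexGraph.Walk f₁ f₁}

/-- **A site read by an interface loop `γ'` of `ω` is not strictly inside a loop `u` of
`siteLoopConfig δ ω` whose interior does not strictly contain that of `γ'`**: `u` does not wind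
about it, or it is within `δ/2` of the trace of `u` (`infDist_polyTrace_le_of_wind_ne_zero`). -/
theorem wind_eq_zero_or_infDist_le {δ : ℝ} (hδ : 0 < δ) (h' : IsSiteInterfaceLoop ω w') {x : Site 2}
    (hx : ∃ d ∈ w'.darts, ∃ e : triGraph.Dart, triEdgeFaces e = (d.snd, d.fst) ∧ (x = e.fst ∨ x = e.snd))
    {u : UnbasedLoop ℂ}
    (hu : ∃ (v : HexVertex) (γ : hexGraph.Walk v v), IsSiteInterfaceLoop ω γ ∧ u = UL⟦δ, γ⟧)
    (hns : ¬ ({z | (siteLoopCurve δ w').wind z ≠ 0} ⊂ {z | u.wind z ≠ 0})) :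
    u.wind (triMeshPoint δ x) = 0 ∨ infDist (triMeshPoint δ x) u.range ≤ δ / 2 := by
  obtain ⟨v, γ, hγ, rfl⟩ := hu
  obtain ⟨d, hd, e, he, hxe⟩ := hx
  obtain ⟨i, hi, hx⟩ := exists_eq_lv_or_rv h' hd he hxe
  have hlen : 0 < γ.length := by have := hγ.isCycle.three_le_length; omega
  simp only [UnbasedLoop.wind_mk, BasedLoop.toCurveClass_mk] at hns ⊢
  rw [or_iff_not_imp_left, range_mk_siteLoopCurve, range_toCurve_eq_polyTrace hlen]
  exact fun hwx ↦ infDist_polyTrace_le_of_wind_ne_zero h' hγ hδ hns hi hx hwx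

/-- **The first generation of the closed-b.c. site-`𝕋` domain ensemble is a stopping set**
(registered helper, wave 3, toward `stub_cascadeReconstruction`): two site configurations agreeing
on every site that is not strictly inside a first-generation loop of the first one — the sites within
`δ/2` of the trace of a loop (which include the sites it reads) counting as not strictly inside — have
the same first generation.  See the module docstring for the proof. -/
theorem firstGen_domLoopsT_eq_of_agree_outside : ∀ (U : Set ℂ) (δ : ℝ) (ω ω' : SiteConfig (Site 2)), 0 < δ → Bornology.IsBounded U → (∀ x : Site 2, (∀ u ∈ (firstGen (domLoopsT U δ ω)).loops, u.wind (triMeshPoint δ x) = 0 ∨ Metric.infDist (triMeshPoint δ x) u.range ≤ δ / 2) → (x ∈ ω ↔ x ∈ ω')) → firstGen (domLoopsT U δ ω') = firstGen (domLoopsT U δ ω) := by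
  intro U δ ω ω' hδ hU hagree
  unfold domLoopsT at hagree ⊢
  set β : SiteConfig (Site 2) := ω ∩ triMeshVertices U δ with hβ
  set β' : SiteConfig (Site 2) := ω' ∩ triMeshVertices U δ with hβ'
  set c : LoopConfig ℂ := siteLoopConfig δ β with hc
  have hfin : β.Finite := (triMeshVertices_finite_holds hU hδ).subset inter_subset_right
  -- the two configurations agree on the sites not strictly inside the first generation of `c`
  have hagree' : ∀ x : Site 2, (∀ u ∈ (firstGen c).loops, u.wind (triMeshPoint δ x) = 0 ∨
      infDist (triMeshPoint δ x) u.range ≤ δ / 2) → (x ∈ β ↔ x ∈ β') :=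
    fun x hx ↦ and_congr_left' (hagree x hx)
  -- Step 1: first-generation loops of `β` are interface loops of `β'`
  have step1 : ∀ {v : HexVertex} {γ : hexGraph.Walk v v}, IsSiteInterfaceLoop β γ →
      UL⟦δ, γ⟧ ∈ (firstGen c).loops → IsSiteInterfaceLoop β' γ := by
    intro v γ hγ hfg
    obtain ⟨-, hmax⟩ := mem_firstGen_loops_iff.1 hfg
    refine (isSiteInterfaceLoop_congr fun x hx ↦ hagree' x fun u hu ↦ ?_).1 hγ
    obtain ⟨huc, -⟩ := mem_firstGen_loops_iff.1 hu
    exact wind_eq_zero_or_infDist_le hδ hγ hx (mem_loops_siteLoopConfig_iff.1 huc) (hmax u huc)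
  -- Step 2 (outside locality): a loop of `β'` not strictly inside the first generation of `c`
  -- is an interface loop of `β`
  have step2 : ∀ {v : HexVertex} {γ : hexGraph.Walk v v}, IsSiteInterfaceLoop β' γ →
      (∀ u ∈ (firstGen c).loops, ¬ ({z | (siteLoopCurve δ γ).wind z ≠ 0} ⊂ {z | u.wind z ≠ 0})) →
      IsSiteInterfaceLoop β γ := by
    intro v γ hγ hns
    refine (isSiteInterfaceLoop_congr fun x hx ↦ hagree' x fun u hu ↦ ?_).2 hγ
    obtain ⟨huc, -⟩ := mem_firstGen_loops_iff.1 hu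
    obtain ⟨v₂, γ₂, hγ₂, rfl⟩ := mem_loops_siteLoopConfig_iff.1 huc
    exact wind_eq_zero_or_infDist_le hδ hγ hx ⟨v₂, γ₂, step1 hγ₂ hu, rfl⟩ (hns _ hu)
  -- Step 3: the two first generations coincide
  refine LoopConfig.ext (funext fun i ↦ Set.ext fun u ↦ ⟨fun hu ↦ ?_, fun hu ↦ ?_⟩)
  · -- a first-generation loop of `β'` is a first-generation loop of `β`
    obtain ⟨hu, hmax'⟩ := hu
    obtain ⟨v, γ, hγ', htype, rfl⟩ := mem_siteLoopConfig_iff.1 hu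
    have hns : ∀ u₂ ∈ (firstGen c).loops,
        ¬ ({z | (siteLoopCurve δ γ).wind z ≠ 0} ⊂ {z | u₂.wind z ≠ 0}) := by
      intro u₂ hu₂
      obtain ⟨hu₂c, -⟩ := mem_firstGen_loops_iff.1 hu₂
      obtain ⟨v₂, γ₂, hγ₂, rfl⟩ := mem_loops_siteLoopConfig_iff.1 hu₂c
      exact hmax' _ (mem_loops_siteLoopConfig_iff.2 ⟨v₂, γ₂, step1 hγ₂ hu₂, rfl⟩)
    have hγ : IsSiteInterfaceLoop β γ := step2 hγ' hns
    refine ⟨mem_siteLoopConfig_iff.2 ⟨v, γ, hγ, htype, rfl⟩, fun v₃ hv₃ hss ↦ ?_⟩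
    -- an enclosing loop of `β` would have an outermost one, of the first generation of `β`
    set S : Set (UnbasedLoop ℂ) :=
      {v' ∈ c.loops | {z | (siteLoopCurve δ γ).wind z ≠ 0} ⊂ {z | v'.wind z ≠ 0}} with hS
    have hSfin : S.Finite := (loops_siteLoopConfig_finite hδ hfin).subset (sep_subset _ _)
    obtain ⟨v₄, hv₄S, hv₄max⟩ :=
      hSfin.exists_maximalFor (fun v' : UnbasedLoop ℂ ↦ {z | v'.wind z ≠ 0}) S ⟨v₃, hv₃, hss⟩
    have hv₄fg : v₄ ∈ (firstGen c).loops := by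
      refine mem_firstGen_loops_iff.2 ⟨hv₄S.1, fun v₅ hv₅ hss₅ ↦ ?_⟩
      have hv₅S : v₅ ∈ S := ⟨hv₅, hv₄S.2.trans hss₅⟩
      exact hss₅.2 (hv₄max hv₅S hss₅.1)
    exact hns v₄ hv₄fg hv₄S.2
  · -- a first-generation loop of `β` is a first-generation loop of `β'`
    obtain ⟨hu, hmax⟩ := hu
    obtain ⟨v, γ, hγ, htype, rfl⟩ := mem_siteLoopConfig_iff.1 hu
    have hfg : UL⟦δ, γ⟧ ∈ (firstGen c).loops :=
      mem_firstGen_loops_iff.2 ⟨LoopConfig.subset_loops c i hu, hmax⟩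
    refine ⟨mem_siteLoopConfig_iff.2 ⟨v, γ, step1 hγ hfg, htype, rfl⟩, fun v' hv' hss ↦ ?_⟩
    obtain ⟨v₁, γ', hγ', rfl⟩ := mem_loops_siteLoopConfig_iff.1 hv'
    have hns : ∀ u₂ ∈ (firstGen c).loops,
        ¬ ({z | (siteLoopCurve δ γ').wind z ≠ 0} ⊂ {z | u₂.wind z ≠ 0}) := by
      intro u₂ hu₂ hss₂
      obtain ⟨hu₂c, -⟩ := mem_firstGen_loops_iff.1 hu₂
      exact hmax u₂ hu₂c (hss.trans hss₂)
    exact hmax _ (mem_loops_siteLoopConfig_iff.2 ⟨v₁, γ', step2 hγ' hns, rfl⟩) hss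

end Config

end Summit.CriticalPhenomena.CardyFormulaZ2.Cruxes.NestingRigidity.MarkovCascadeOneGeneration

end
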